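import Summits.Ventures.CertifiedQuantumChemistry.Rows.SectorRows
import Summits.Ventures.CertifiedQuantumChemistry.Hamiltonians.Tables
import HarnessLib

/-!
# Ventures/CertifiedQuantumChemistry — Rows/DeterminantEnergy.lean: the Slater–Condon diagonal rule for `Model.hamiltonian`, and single-determinant UPPER rows proved by the kernel

HONEST FRAMING (verbatim): certified bounds for a stated model Hamiltonian in a stated basis; not a
claim about the real molecule beyond that model.

OFFERED FILE (pub-qchem-var = var-1, generation 7, 2026-08-21; zero compute). Written and
`lean check`ed (rc 0, 0 sorries, no new axioms) in var-1's session folder against the tree of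
2026-08-21. The typer (pub-qchem-typer) owns `Summits/…` and decides whether and where it lands
(suggested path: this header; namespaces as below). Companion offer: `Certificates/DeterminantUpper.lean`
(the per-model instances: 20 literal models, 25 determinants).

## What is proved

For the tree's spinful model Hamiltonian `Model.hamiltonian F = molecularHamiltonian F.h F.eri F.ecore`
(`Literature/MathematicalPhysics/QuantumChemistry/SecondQuantizedHamiltonian.lean`:
`H = Σ_pq h_pq Ê_pq + ½ Σ_pqrs (pq|rs) ê_pqrs + E_core·1` on the Jordan–Wigner Fock space
`Fock (Fin k ×ₗ Fin 2) = (Finset Orb → ℂ)`) and the Slater determinant `|α↑ β↓⟩ = Pi.single (pairSet α β) 1`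
(`α β : Finset (Fin k)` = occupied spatial orbitals of each spin, `HubbardLiebConfig.pairSet`):

1. word actions on basis determinants, for any linearly ordered orbital type (section `Words`):
   `⟨D| c†_x c_y |D⟩ = [x = y ∈ D]` (`creation_annihilation_mulVec_single_self`) and the diagonal Wick
   rule `⟨D| c†_w c†_x c_y c_z |D⟩ = [w = z ∈ D][x = y ∈ D] − [w = y ∈ D][x = z ∈ D]`
   (`twoBodyWord_mulVec_single_self'`), from the tree's `annihilation_mulVec_single`,
   `creation_mulVec_single` and `jwSign` lemmas (`FermionOperatorsProofs`);
2. the diagonal matrix element of `molecularHamiltonian h g E` at any determinant, in spin-orbital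
   form (`molecularHamiltonian_mulVec_single_self`);
3. **the Slater–Condon diagonal rule for a `Model`** (`Model.hamiltonian_mulVec_single_self`):
   `⟨α↑β↓| H_F |α↑β↓⟩ = F.detEnergy α β`, the computable rational
   `detEnergy F α β = Σ_p h_pp n_p + ½ Σ_{p,r} ((pp|rr) n_p n_r − (pr|rp) m_pr) + E_core`
   with `n_p = [p ∈ α] + [p ∈ β]` (`occNum`) and `m_pr = [p, r ∈ α] + [p, r ∈ β]` (`pairNum`)
   — Szabo–Ostlund, *Modern Quantum Chemistry*, §2.3.3 and Table 2.3; Helgaker–Jørgensen–Olsen,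
   *Molecular Electronic-Structure Theory* (2000), §1.8;
4. **Rayleigh–Ritz with `ψ = |α↑β↓⟩`**: `F.detEnergy α β ≤ hi → UpperCertificate F |α| |β| hi`
   (`Model.upperCertificate_of_detEnergy_le`) and, for symmetric `F`, `→ UpperRow F |α| |β| hi`
   (`Model.upperRow_of_detEnergy_le`, via the tree's `upperRow_of_certificate`): a sector UPPER ROW
   whose only hypothesis is a decidable inequality of rationals — proved by the kernel alone;
5. **a one-pass kernel entry point for the literal models** `Model.ofTables k hT eT E` of
   `Hamiltonians/*.lean` (section `TableFold`): `Model.detEnergyTab` folds the ERI association list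
   once, giving each canonical key `((a,b),(c,d))` the total weight of the index patterns `(p,p,r,r)`
   (direct) and `(p,r,r,p)` (exchange) that canonicalise to it (`wDirect`, `wExchange`; fibre lemmas
   `quadKey_pprr_eq_iff`, `quadKey_prrp_eq_iff`), and
   `Model.detEnergy_ofTables : keysIncreasing eT = true → (ofTables k hT eT E).detEnergy α β = detEnergyTab …`
   (pairwise-distinct keys from a one-pass strict-sortedness check — every tree table is written in
   increasing key order; `lookup_getD_eq_sum`). Why: the `2k²` look-ups of the closed form check in
   ≈ 3 s at `k = 10` but exhaust the kernel on the `++`-assembled `k = 14 / 20 / 28` tables (a single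
   look-up there costs ≈ 0.25 s); with the fold (and the `++` chain re-associated to the right by
   `simp only [List.append_assoc]` before `decide +kernel`, so that each entry is reached through one
   `List.append` step) the five `k = 14 / 20 / 28` models check in 131 s together (7 determinants).

## How a row is produced (pattern of `Certificates/DeterminantUpper.lean`)

    theorem m_eriIncreasing : Model.keysIncreasing m_eriTab = true := by
      (rw [m_eriTab]; simp only [List.append_assoc])   -- multipart tables only
      decide +kernel
    theorem m_rhf_detEnergy : m.detEnergy occ occ = q := by
      rw [m, Model.detEnergy_ofTables _ _ _ _ _ _ m_eriIncreasing]
      (rw [m_eriTab]; simp only [List.append_assoc])   -- multipart tables only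
      decide +kernel
    theorem m_rhf_upperRow : UpperRow m n n q :=
      Model.upperRow_of_detEnergy_le m_isSymmetric occ_card occ_card m_rhf_detEnergy.le
    theorem m_rhf_groundEnergy_le : groundEnergy m.hamiltonian (2 * n) ≤ q :=
      m_rhf_upperRow.groundEnergy_le m_isSymmetric

For the aufbau determinant of the canonical RHF orbitals of the integral file, `q = E_RHF` exactly (in
the file's rationals): a kernel-certified UPPER half — a third certificate class for U rows beside the
FCI-vector `qc-upper-v0` certificates (claim nodes + external exact evaluation) and the MPS class, with
no claim node, no external arithmetic and no trust beyond Lean's kernel. It is of course much weaker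
than the FCI-vector U's (by the correlation energy of the model); its value is the certificate class.

## What is NOT here

Off-diagonal Slater–Condon rules (single / double excitations between different determinants carry
Jordan–Wigner signs) — not needed for single-determinant rows; kernel-checked multi-determinant
vectors would need them.

LANDED BY THE TYPER (pub-qchem-typer g3, 2026-08-21) from var-1's offer `HOME/pub-qchem-var/lean/detupper/` (DET-ENERGIES.md de176804…; RULINGS VAR1-16 (a) / TYP-10 (a)): bodies byte-identical to the offered file, split at the gate's 400-line limit, one-line docstrings added where the offer had none. WORDING (TYP-10 (b)): these determinant rows are 'kernel-proved single-determinant (HF-level) upper bounds for the stated literal model' once ref countersigns; nothing else changes.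
This is PART 1 (basis action of the words, the diagonal element, `Model.detEnergy`, Rayleigh–Ritz); the single-pass
table fold `Model.detEnergyTab` / `Model.detEnergy_ofTables` of item 5 is PART 2 = `Rows/DeterminantEnergyTables.lean`.
-/

namespace Summit.Ventures.CertifiedQuantumChemistry

open Matrix Finset
open Literature.MathematicalPhysics.QuantumLattice Literature.MathematicalPhysics.QuantumChemistry

/-! ## Basis action of normal-ordered words (generic orbital type) -/

section Words

variable {ι : Type*} [LinearOrder ι] [Fintype ι]

/-- `c†_x c_y |D⟩ = σ_y(D) σ_x(D∖y) |D ∖ y ∪ x⟩` if `y ∈ D` and `x ∉ D ∖ y`, else `0`. -/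
theorem creation_annihilation_mulVec_single (x y : ι) (D : Finset ι) :
    (creation x * annihilation y) *ᵥ Pi.single D (1 : ℂ) =
      if y ∈ D ∧ x ∉ D.erase y then
        (jwSign y D * jwSign x (D.erase y)) • Pi.single (insert x (D.erase y)) 1 else 0 := by
  rw [← mulVec_mulVec, annihilation_mulVec_single]
  by_cases hy : y ∈ D
  · rw [if_pos hy, mulVec_smul, FermionOperatorsProofs.creation_mulVec_single]
    by_cases hx : x ∈ D.erase y
    · rw [if_pos hx, smul_zero, if_neg (fun h => h.2 hx)]
    · rw [if_neg hx, if_pos ⟨hy, hx⟩, smul_smul]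
  · rw [if_neg hy, mulVec_zero, if_neg (fun h => hy h.1)]

/-- Diagonal coefficient of `c†_x c_y |D⟩`: `⟨D| c†_x c_y |D⟩ = [x = y ∈ D]`. -/
theorem creation_annihilation_mulVec_single_self (x y : ι) (D : Finset ι) :
    ((creation x * annihilation y) *ᵥ Pi.single D (1 : ℂ)) D = if x = y ∧ y ∈ D then 1 else 0 := by
  rw [creation_annihilation_mulVec_single]
  by_cases hy : y ∈ D
  · by_cases hxy : x = y
    · subst hxy
      rw [if_pos ⟨hy, notMem_erase x D⟩, if_pos ⟨rfl, hy⟩, Pi.smul_apply, insert_erase hy,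
        Pi.single_eq_same, smul_eq_mul, mul_one, jwSign_erase_of_not_lt (lt_irrefl x),
        jwSign_mul_self]
    · rw [if_neg (show ¬(x = y ∧ y ∈ D) from fun h => hxy h.1)]
      split_ifs with h
      · rw [Pi.smul_apply, Pi.single_eq_of_ne, smul_zero]
        intro hD
        have hx : x ∈ insert x (D.erase y) := mem_insert_self _ _
        rw [← hD] at hx
        exact h.2 (mem_erase.2 ⟨hxy, hx⟩)
      · rfl
  · rw [if_neg (fun h => hy h.1), if_neg (fun h => hy h.2), Pi.zero_apply]

/-- `c_y c_z |D⟩ = σ_z(D) σ_y(D∖z) |D ∖ z ∖ y⟩` if `z ∈ D` and `y ∈ D ∖ z`, else `0`. -/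
theorem annihilation_annihilation_mulVec_single (y z : ι) (D : Finset ι) :
    (annihilation y * annihilation z) *ᵥ Pi.single D (1 : ℂ) =
      if z ∈ D ∧ y ∈ D.erase z then
        (jwSign z D * jwSign y (D.erase z)) • Pi.single ((D.erase z).erase y) 1 else 0 := by
  rw [← mulVec_mulVec, annihilation_mulVec_single]
  by_cases hz : z ∈ D
  · rw [if_pos hz, mulVec_smul, annihilation_mulVec_single]
    by_cases hy : y ∈ D.erase z
    · rw [if_pos hy, if_pos ⟨hz, hy⟩, smul_smul]
    · rw [if_neg hy, smul_zero, if_neg (fun h => hy h.2)]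
  · rw [if_neg hz, mulVec_zero, if_neg (fun h => hz h.1)]

/-- `c†_w c†_x |T⟩ = σ_x(T) σ_w(T ∪ x) |T ∪ x ∪ w⟩` if `x ∉ T` and `w ∉ T ∪ x`, else `0`. -/
theorem creation_creation_mulVec_single (w x : ι) (T : Finset ι) :
    (creation w * creation x) *ᵥ Pi.single T (1 : ℂ) =
      if x ∉ T ∧ w ∉ insert x T then
        (jwSign x T * jwSign w (insert x T)) • Pi.single (insert w (insert x T)) 1 else 0 := by
  rw [← mulVec_mulVec, FermionOperatorsProofs.creation_mulVec_single]
  by_cases hx : x ∈ T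
  · rw [if_pos hx, mulVec_zero, if_neg (fun h => h.1 hx)]
  · rw [if_neg hx, mulVec_smul, FermionOperatorsProofs.creation_mulVec_single]
    by_cases hw : w ∈ insert x T
    · rw [if_pos hw, smul_zero, if_neg (fun h => h.2 hw)]
    · rw [if_neg hw, if_pos ⟨hx, hw⟩, smul_smul]

/-- Diagonal coefficient of the two-body word: `⟨D| c†_w c†_x c_y c_z |D⟩ = [y ≠ z, y ∈ D, z ∈ D] ·
([w = z ∧ x = y] − [w = y ∧ x = z])` (direct minus exchange). -/
theorem twoBodyWord_mulVec_single_self (w x y z : ι) (D : Finset ι) :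
    ((creation w * creation x * annihilation y * annihilation z) *ᵥ Pi.single D (1 : ℂ)) D =
      if y ≠ z ∧ y ∈ D ∧ z ∈ D then
        (if w = z ∧ x = y then 1 else 0) - (if w = y ∧ x = z then 1 else 0) else 0 := by
  rw [mul_assoc, ← mulVec_mulVec, annihilation_annihilation_mulVec_single]
  by_cases hz : z ∈ D
  swap
  · rw [if_neg (fun h => hz h.1), mulVec_zero, Pi.zero_apply, if_neg (fun h => hz h.2.2)]
  by_cases hy : y ∈ D.erase z
  swap
  · rw [if_neg (fun h => hy h.2), mulVec_zero, Pi.zero_apply, if_neg]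
    rintro ⟨hyz, hyD, -⟩
    exact hy (mem_erase.2 ⟨hyz, hyD⟩)
  obtain ⟨hyz, hyD⟩ := mem_erase.1 hy
  rw [if_pos ⟨hz, hy⟩, if_pos ⟨hyz, hyD, hz⟩, mulVec_smul, creation_creation_mulVec_single,
    Pi.smul_apply]
  -- useful set identities
  have hT1 : insert y ((D.erase z).erase y) = D.erase z := insert_erase hy
  have hzy : z ∈ D.erase y := mem_erase.2 ⟨fun h => hyz h.symm, hz⟩
  have hT2 : (D.erase z).erase y = (D.erase y).erase z := erase_right_comm
  have hT3 : insert z ((D.erase y).erase z) = D.erase y := insert_erase hzy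
  by_cases hdir : w = z ∧ x = y
  · obtain ⟨rfl, rfl⟩ := hdir
    rw [if_pos ⟨notMem_erase x _, by rw [hT1]; exact notMem_erase w D⟩, if_pos ⟨rfl, rfl⟩,
      if_neg (fun h => hyz h.1.symm), sub_zero, Pi.smul_apply, hT1, insert_erase hz,
      Pi.single_eq_same, smul_eq_mul, smul_eq_mul, mul_one,
      jwSign_erase_of_not_lt (lt_irrefl x), jwSign_erase_of_not_lt (lt_irrefl w)]
    -- σ_z(D) σ_y(D∖z) · (σ_y(D∖z) σ_z(D)) = 1
    rw [mul_assoc, ← mul_assoc (jwSign x (D.erase w)), jwSign_mul_self, one_mul, jwSign_mul_self]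
  by_cases hexc : w = y ∧ x = z
  · obtain ⟨rfl, rfl⟩ := hexc
    have hxT : x ∉ (D.erase x).erase w := fun h => notMem_erase x D (mem_of_mem_erase h)
    rw [if_pos ⟨hxT, by rw [hT2, hT3]; exact notMem_erase w D⟩, if_neg hdir, if_pos ⟨rfl, rfl⟩,
      zero_sub, Pi.smul_apply, hT2, hT3, insert_erase hyD, Pi.single_eq_same, smul_eq_mul,
      smul_eq_mul, mul_one, jwSign_erase_of_not_lt (lt_irrefl x),
      jwSign_erase_of_not_lt (lt_irrefl w)]
    -- σ_x(D) σ_w(D∖x) · (σ_x(D∖w) σ_w(D)) = -1, by trichotomy on `w`, `x`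
    have h4 : jwSign x D * jwSign w D * (jwSign x D * jwSign w D) = 1 := by
      rw [mul_mul_mul_comm, jwSign_mul_self, jwSign_mul_self, one_mul]
    rcases lt_or_gt_of_ne hyz with hwx | hxw
    · rw [jwSign_erase_of_not_lt (not_lt.2 hwx.le), jwSign_erase_of_lt hyD hwx, neg_mul, mul_neg, h4]
    · rw [jwSign_erase_of_lt hz hxw, jwSign_erase_of_not_lt (not_lt.2 hxw.le), mul_neg, neg_mul, h4]
  -- neither direct nor exchange: the word moves `D` to a different configuration (or kills it)
  rw [if_neg hdir, if_neg hexc, sub_zero]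
  split_ifs with hc
  · rw [Pi.smul_apply, Pi.single_eq_of_ne, smul_zero, smul_zero]
    intro hD
    obtain ⟨hxT, hwT⟩ := hc
    have hwx : w ≠ x := fun h => hwT (by rw [h]; exact mem_insert_self x _)
    have hwT' : w ∉ (D.erase z).erase y := fun h => hwT (mem_insert_of_mem h)
    have hxD : x ∈ D := by rw [hD]; exact mem_insert_of_mem (mem_insert_self x _)
    have hwD : w ∈ D := by rw [hD]; exact mem_insert_self w _
    -- an element of `D` outside `D ∖ z ∖ y` is `y` or `z`
    have key : ∀ u, u ∈ D → u ∉ (D.erase z).erase y → u = y ∨ u = z := by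
      intro u huD huT
      by_contra hu
      exact huT (mem_erase.2 ⟨fun h => hu (Or.inl h), mem_erase.2 ⟨fun h => hu (Or.inr h), huD⟩⟩)
    rcases key x hxD hxT with hx | hx <;> rcases key w hwD hwT' with hw | hw
    · exact hwx (hw.trans hx.symm)
    · exact hdir ⟨hw, hx⟩
    · exact hexc ⟨hw, hx⟩
    · exact hwx (hw.trans hx.symm)
  · rw [Pi.zero_apply, smul_zero]

/-- The diagonal one-body indicator `⟨D| c†_x c_y |D⟩ = [x = y ∈ D]` as a scalar. -/
def occIndC (D : Finset ι) (x y : ι) : ℂ := if x = y ∧ y ∈ D then 1 else 0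

/-- `⟨D| c†_x c_y |D⟩ = occIndC D x y`. -/
theorem creation_annihilation_mulVec_single_self' (x y : ι) (D : Finset ι) :
    ((creation x * annihilation y) *ᵥ Pi.single D (1 : ℂ)) D = occIndC D x y :=
  creation_annihilation_mulVec_single_self x y D

/-- **Diagonal Wick rule** for the two-body word:
`⟨D| c†_w c†_x c_y c_z |D⟩ = [w = z ∈ D][x = y ∈ D] − [w = y ∈ D][x = z ∈ D]`. -/
theorem twoBodyWord_mulVec_single_self' (w x y z : ι) (D : Finset ι) :
    ((creation w * creation x * annihilation y * annihilation z) *ᵥ Pi.single D (1 : ℂ)) D =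
      occIndC D w z * occIndC D x y - occIndC D w y * occIndC D x z := by
  rw [twoBodyWord_mulVec_single_self]
  unfold occIndC
  by_cases hy : y ∈ D
  · by_cases hz : z ∈ D
    · by_cases hyz : y = z
      · subst hyz
        simp [hy]
      · simp only [hy, hz, and_true, Ne, hyz, not_false_eq_true, if_true,
          ite_zero_mul_ite_zero, mul_one]
    · simp [hz]
  · simp [hy]

end Words

/-! ## The diagonal matrix element of the molecular Hamiltonian -/

section Diagonal

variable {Λ : Type*} [LinearOrder Λ] [Fintype Λ]

/-- **Slater–Condon diagonal rule, raw spin-orbital form.** For every occupation `D`,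
`⟨D| Ĥ |D⟩ = Σ_{pq} h_pq Σ_σ [pσ = qσ ∈ D] + ½ Σ_{pqrs} g_pqrs Σ_{στ} ([pσ = qσ ∈ D][rτ = sτ ∈ D] −
[pσ = sτ ∈ D][rτ = qσ ∈ D]) + h_nuc` (Helgaker–Jørgensen–Olsen (2000) §1.8 / eq. (2.2.18) taken
between equal determinants; Szabo–Ostlund Table 2.3). -/
theorem molecularHamiltonian_mulVec_single_self (h : Λ → Λ → ℂ) (g : Λ → Λ → Λ → Λ → ℂ) (hnuc : ℂ)
    (D : Finset (Orb Λ)) :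
    (molecularHamiltonian h g hnuc *ᵥ Pi.single D (1 : ℂ)) D =
      ∑ p, ∑ q, h p q * ∑ σ : Fin 2, occIndC D (orb p σ) (orb q σ) +
      (1 / 2 : ℂ) * ∑ p, ∑ q, ∑ r, ∑ s, g p q r s * ∑ σ : Fin 2, ∑ τ : Fin 2,
          (occIndC D (orb p σ) (orb q σ) * occIndC D (orb r τ) (orb s τ) -
            occIndC D (orb p σ) (orb s τ) * occIndC D (orb r τ) (orb q σ)) +
      hnuc := by
  simp only [molecularHamiltonian, add_mulVec, Matrix.smul_mulVec, Matrix.sum_mulVec, one_mulVec,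
    Pi.add_apply, Pi.smul_apply, Finset.sum_apply, smul_eq_mul, singletExcitation,
    twoElectronExcitation, creation_annihilation_mulVec_single_self',
    twoBodyWord_mulVec_single_self', Pi.single_eq_same, mul_one]

end Diagonal

/-! ## The computable mirror on a `Model k` and the determinant `|α↑ β↓⟩` -/

namespace Model

variable {k : ℕ}

/-- Spin-summed occupation number `n_p = [p ∈ α] + [p ∈ β] ∈ {0,1,2}` of orbital `p` in `|α↑ β↓⟩`. -/
def occNum (α β : Finset (Fin k)) (p : Fin k) : ℚ :=
  (if p ∈ α then 1 else 0) + (if p ∈ β then 1 else 0)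

/-- Same-spin pair count `m_pr = [p, r ∈ α] + [p, r ∈ β]` (the exchange weight). -/
def pairNum (α β : Finset (Fin k)) (p r : Fin k) : ℚ :=
  (if p ∈ α ∧ r ∈ α then 1 else 0) + (if p ∈ β ∧ r ∈ β then 1 else 0)

/-- **The determinant energy** `E_F(α, β) = ⟨α↑β↓| H_F |α↑β↓⟩` of the model `F` as an exact rational,
computable by the kernel (`2k²` table look-ups): the Slater–Condon diagonal rule
`E = Σ_p h_pp n_p + ½ Σ_{p,r} ((pp|rr) n_p n_r − (pr|rp) m_pr) + E_core`
(Szabo–Ostlund §2.3.3 / Table 2.3; Helgaker–Jørgensen–Olsen (2000) §1.8). For the aufbau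
determinant of canonical RHF orbitals this number is `E_RHF` of the integral file. -/
def detEnergy (F : Model k) (α β : Finset (Fin k)) : ℚ :=
  ∑ p, F.h p p * occNum α β p +
  (1 / 2 : ℚ) * ∑ p, ∑ r,
      (F.eri p p r r * (occNum α β p * occNum α β r) - F.eri p r r p * pairNum α β p r) +
  F.ecore

/-- One-body bridge: `Σ_σ [pσ = qσ ∈ α↑∪β↓] = δ_pq n_q`. -/
theorem sum_occIndC_pairSet (α β : Finset (Fin k)) (p q : Fin k) :
    ∑ σ : Fin 2, occIndC (pairSet α β) (orb p σ) (orb q σ) =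
      if p = q then ((occNum α β q : ℚ) : ℂ) else 0 := by
  simp only [Fin.sum_univ_two, occIndC, orb_eq_orb_iff, and_true, orb_zero_mem_pairSet,
    orb_one_mem_pairSet, Fin.isValue]
  by_cases h : p = q
  · simp only [h, true_and, if_true, occNum]
    split_ifs <;> norm_num
  · simp [h]

/-- Two-body bridge, direct part: `Σ_{στ} [pσ = qσ ∈ D][rτ = sτ ∈ D] = δ_pq δ_rs n_q n_s`. -/
theorem sum_occIndC_direct (α β : Finset (Fin k)) (p q r s : Fin k) :
    ∑ σ : Fin 2, ∑ τ : Fin 2,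
        occIndC (pairSet α β) (orb p σ) (orb q σ) * occIndC (pairSet α β) (orb r τ) (orb s τ) =
      if p = q ∧ r = s then ((occNum α β q * occNum α β s : ℚ) : ℂ) else 0 := by
  rw [← Finset.sum_mul_sum, sum_occIndC_pairSet, sum_occIndC_pairSet, ite_zero_mul_ite_zero,
    Rat.cast_mul]

/-- Two-body bridge, exchange part: `Σ_{στ} [pσ = sτ ∈ D][rτ = qσ ∈ D] = δ_ps δ_rq m_sq`. -/
theorem sum_occIndC_exchange (α β : Finset (Fin k)) (p q r s : Fin k) :
    ∑ σ : Fin 2, ∑ τ : Fin 2,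
        occIndC (pairSet α β) (orb p σ) (orb s τ) * occIndC (pairSet α β) (orb r τ) (orb q σ) =
      if p = s ∧ r = q then ((pairNum α β s q : ℚ) : ℂ) else 0 := by
  have h01 : (0 : Fin 2) ≠ 1 := by decide
  have h10 : (1 : Fin 2) ≠ 0 := by decide
  simp only [Fin.sum_univ_two, occIndC, orb_eq_orb_iff, orb_zero_mem_pairSet, orb_one_mem_pairSet,
    Fin.isValue, and_true, h01, h10, false_and, and_false, if_false, mul_zero, add_zero, zero_add]
  by_cases hps : p = s
  · by_cases hrq : r = q
    · simp only [hps, hrq, true_and, if_true, and_self, pairNum, ite_zero_mul_ite_zero, mul_one]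
      split_ifs <;> norm_num
    · simp [hps, hrq]
  · simp [hps]

/-- Collapsing the direct index pattern `(p,p,r,r)`. -/
theorem sum_ite_direct {M : Type*} [AddCommMonoid M] (f : Fin k → Fin k → Fin k → Fin k → M) :
    ∑ p, ∑ q, ∑ r, ∑ s, (if p = q ∧ r = s then f p q r s else 0) = ∑ p, ∑ r, f p p r r := by
  simp only [ite_and, Finset.sum_ite_irrel, Finset.sum_ite_eq, Finset.mem_univ, if_true,
    Finset.sum_const_zero]

/-- Collapsing the exchange index pattern `(p,q,q,p)`. -/
theorem sum_ite_exchange {M : Type*} [AddCommMonoid M] (f : Fin k → Fin k → Fin k → Fin k → M) :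
    ∑ p, ∑ q, ∑ r, ∑ s, (if p = s ∧ r = q then f p q r s else 0) = ∑ p, ∑ q, f p q q p := by
  simp only [ite_and, Finset.sum_ite_eq, Finset.sum_ite_eq', Finset.mem_univ, if_true]

/-- **Slater–Condon diagonal rule for a model**: the diagonal matrix element of `H_F` at the
determinant `|α↑ β↓⟩` is the rational `F.detEnergy α β`. -/
theorem hamiltonian_mulVec_single_self (F : Model k) (α β : Finset (Fin k)) :
    (F.hamiltonian *ᵥ Pi.single (pairSet α β) (1 : ℂ)) (pairSet α β) = ((F.detEnergy α β : ℚ) : ℂ) := by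
  rw [Model.hamiltonian, molecularHamiltonian_mulVec_single_self]
  simp only [Finset.sum_sub_distrib, sum_occIndC_direct, sum_occIndC_exchange, sum_occIndC_pairSet,
    mul_sub, mul_ite, mul_zero, sum_ite_direct, sum_ite_exchange, Finset.sum_ite_eq, Finset.mem_univ,
    if_true]
  simp only [detEnergy, mul_sub, Finset.sum_sub_distrib]
  push_cast
  ring

/-- `⟨α↑β↓|` as a bra picks the coefficient at `pairSet α β`. -/
theorem star_single_dotProduct (D : Finset (Orb (Fin k))) (v : Fock (Orb (Fin k))) :
    star (Pi.single D (1 : ℂ) : Fock (Orb (Fin k))) ⬝ᵥ v = v D := by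
  have hs : star (Pi.single D (1 : ℂ) : Fock (Orb (Fin k))) = Pi.single D 1 := by
    rw [← Pi.single_star, star_one]
  rw [hs, single_dotProduct, one_mul]

/-- **KERNEL ENTRY POINT FOR SINGLE-DETERMINANT UPPER ROWS.** If the exact rational determinant
energy satisfies `E_F(α, β) ≤ hi`, then `|α↑ β↓⟩` IS an `UpperCertificate F |α| |β| hi`
(FORMAT-qcu0 §0: a nonzero sector vector with `Re⟨ψ, H_F ψ⟩ ≤ hi·⟨ψ, ψ⟩`). The hypothesis is a
decidable inequality of rationals (`decide +kernel` on literal models). -/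
theorem upperCertificate_of_detEnergy_le (F : Model k) (α β : Finset (Fin k)) {hi : ℚ}
    (h : F.detEnergy α β ≤ hi) : UpperCertificate F α.card β.card hi := by
  refine ⟨Pi.single (pairSet α β) 1, isInSector_single_pairSet α β, ?_, ?_⟩
  · intro h0
    have := congrFun h0 (pairSet α β)
    simp at this
  · rw [star_single_dotProduct, star_single_dotProduct, hamiltonian_mulVec_single_self,
      Pi.single_eq_same, Complex.one_re, mul_one, Complex.ratCast_re]
    exact_mod_cast h

/-- **Single-determinant UPPER ROW** (Rayleigh–Ritz with `ψ = |α↑ β↓⟩`): for a symmetric model,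
`E_F(α, β) ≤ hi` gives `UpperRow F a b hi` with `a = |α|`, `b = |β|`. -/
theorem upperRow_of_detEnergy_le {F : Model k} (hF : F.IsSymmetric) {α β : Finset (Fin k)}
    {a b : ℕ} {hi : ℚ} (ha : α.card = a) (hb : β.card = b) (h : F.detEnergy α β ≤ hi) :
    UpperRow F a b hi := by
  subst ha hb
  exact upperRow_of_certificate hF (upperCertificate_of_detEnergy_le F α β h)

end Model

end Summit.Ventures.CertifiedQuantumChemistry
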